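import Summits.QuantumFields.BalabanUV.T4Continuum.Support.SmallCouplingEntryDecayCovariant
import Summits.QuantumFields.BalabanUV.T4Continuum.Support.AveragingKernelRows
import Summits.QuantumFields.BalabanUV.T4Continuum.Spine.NE2BalabanDecayRate

/-!
# T⁴ programme, NE2 (U1a) sub-row Δ3 (`T4-U1a.S-NE2-D3-WALK°`) — `hdec` FOR THE TYPED TIER-B PERTURBATION `balabanPert = covPertC + avgPert + P₄`
# AT SMALL COUPLING ON A CUBIC UNIT TORUS (a = 1), AND ROOT B's DECAY STATIONS WITH `hdec` DISCHARGED modulo two displayed entry laws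

NE2 formalisation swarm `b2b-balaban-t4-ne2-formalise-*`, leaf prover 05 (gen 6); file 2 of the supplier item «NE2-Δ3-TIERB-HDEC» (after
«Δ3-GRAD-TRANSPORT» p223049∕p223232∕p223413 and «Δ3-COVLAP-HDEC» `ColourMultiplierRows` p224989 ∕ `SmallCouplingEntryDecayCovariant`).  Referee
condition c14 of the sub-row reads «decay currency ⇐ ROOT B ∧ hdec (open)»: the owner's `NE2BalabanDecayRate.decayStations_pertCovC` turns the
tier-B `PerturbationLaws` plus a DISPLAYED level-uniform entry decay `hdec` of `pertCovC (balabanPert …) t k` into King's (4.38) decay stations.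
THIS FILE discharges `hdec` for the typed `balabanPert L M 1 R P₄ = covPertC L M R + avgPert L M 1 R + P₄` (`NE2BalabanLayer.tierBPert`,
`NE2BalabanRoot.balabanPert`) at small coupling from: the owner's regularity class `RegularTransporters L M R α β` (for `covPertC`, file
`SmallCouplingEntryDecayCovariant`), the DISPLAYED transport entry law `hT : ‖T(Γ_{y,j,μ,t}) − 1‖ ≤ τ` along the canonical contours (for
`avgPert`, file `AveragingKernelRows` — the entry-level analogue of tier B's displayed transport-error laws `hE`), and the DISPLAYED weighted
relative bound `hP₄w` of the gauge slot `P₄·(𝒢⊗1)` (the weighted analogue of tier B's displayed `hP₄`):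
 * §1 **`wrow_avgPert_le`**: `Σ_j e^{δ′ρ}‖(avgPert L M a R k)(i,j)‖ ≤ ‖a‖·(card o)²·τ(2+τ)·e^{2δ′}` (level-uniform);
 * §2 **`wrow_balabanPert_mul_calGlev_le`** — the weighted (H-bd) analogue for the WHOLE tier-B perturbation:
   `Σ_j e^{δ′ρ}‖(balabanPert L M 1 R P₄ k·(𝒢^{(k)}⊗1))(i,j)‖ ≤ κ_w := κ_cov + κ_avg·W_G(δ′) + κ₄w`;
 * §3 **`hdec_pertCovC_balabanPert`**: `‖t‖·κ_w < 1 ⟹ ∀ k, EntryDecay dist₀ (pertCovC L M 1 _ (balabanPert L M 1 R P₄) t k) (W_G∕(1 − ‖t‖κ_w)) δ′`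
   (gen 5's `hdec_pertCovC_small_rel` BY NAME); **`decayStations_balabanPert`**: the owner's `decayStations_pertCovC` BY NAME with ANY tier-B
   `PerturbationLaws` witness `hpert` (e.g. `NE2BalabanRoot.perturbationLaws_balaban`, CONDITIONAL on NE3 ∕ `hreg` ∕ `hE` ∕ `hP₄` as there) and THIS
   `hdec` — ROOT B's typed perturbation in King's (4.38) decay shape with `hdec` NO LONGER a displayed binder: what is displayed instead is
   (`hreg`, `hT`, `hP₄w`, the cubic torus, a = 1, the rate window, the coupling discs).

HONEST FRAMING (T4-DAG p. 1).  MODEL level throughout (tier B = typed operators; no B0 identification with [B9] (3.23)–(3.26) as printed);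
a = 1 (pv15's (1.110) chain); CUBIC unit tori `M ≡ N₀`; small coupling = explicit discs (NOT `‖t‖ ≤ 1`); `hT` and `hP₄w` DISPLAYED (entry ∕
weighted analogues of tier B's displayed `hE` ∕ `hP₄`; not derived here); constants crude; nothing printed asserted ([B5] (1.18)∕(1.110),
[B9] (3.14)–(3.16)∕(3.26)∕(3.35) are TEXT LOCATIONS); sub-row Δ3 NOT closed for Bałaban's carrier (a ≠ 1, non-cubic tori, `hT`∕`hP₄w` open);
**NE2 (U1a) NOT PROVED**; spine PROVED 0/9; NOT infinite volume, NOT a mass gap, NOT Clay.  HONEST DEPENDENCY: continuum YM on T⁴ ⇐ BetaPertH ∧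
nine spine estimates (0/9 proved); BetaPertH ⇐ (D1) ∧ (D4) ∧ CAP+tail; G-an2-4 gates asym, D1 and NE2/3/4.  ABSOLUTE RULE kept; no `def`;
no `sorry`.
-/

noncomputable section

open scoped BigOperators ComplexConjugate Matrix Matrix.Norms.L2Operator Kronecker
open Finset

namespace Summit.QuantumFields.BalabanUV.T4Continuum.SmallCouplingEntryDecayTierB

open Literature.MathematicalPhysics.QuantumFieldTheory.Balaban1983to89.B5Prop11Plancherel (Tor fine shiftM fdiff unitVec Cst)
open Literature.MathematicalPhysics.QuantumFieldTheory.Balaban1983to89.B5G183RateUnitTower (lev)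
open Literature.MathematicalPhysics.QuantumFieldTheory.Balaban1983to89.B4TorusKernel (periodConst)
open Literature.MathematicalPhysics.QuantumFieldTheory.Balaban1983to89.B4TorusKernel.MultiPeriod (torusSupNorm)
open Literature.MathematicalPhysics.QuantumFieldTheory.Balaban1983to89.B4Sect5Proof (latticeConst)
open Literature.MathematicalPhysics.QuantumFieldTheory.Balaban1983to89.B5Blocks16 (blockOf)
open Literature.MathematicalPhysics.QuantumFieldTheory.Balaban1983to89.B5Block118 (QvOp)
open Literature.MathematicalPhysics.QuantumFieldTheory.Balaban1983to89.B5DeltaA169 (DeltaA)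
open Literature.MathematicalPhysics.QuantumFieldTheory.Balaban1983to89.B5G183Strip (kappa183)
open Literature.MathematicalPhysics.QuantumFieldTheory.Balaban1983to89.B5G183CovDecay (MD183)
open Literature.MathematicalPhysics.QuantumFieldTheory.Balaban1983to89.B6LowerBound2153Torus (rep)
open Summit.QuantumFields.BalabanUV.T4Continuum
open Summit.QuantumFields.BalabanUV.T4Continuum.BalabanAveragedTowerUnit (idx calGlev)
open Summit.QuantumFields.BalabanUV.T4Continuum.BackgroundResolventTower (PerturbationLaws Cpert)
open Summit.QuantumFields.BalabanUV.T4Continuum.KingPairingPlantedLaw (calDalev JpcT CJ)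
open Summit.QuantumFields.BalabanUV.T4Continuum.BlockPairingGeometry (tau)
open Summit.QuantumFields.BalabanUV.T4Continuum.BlockMultiplication (siteMul)
open Summit.QuantumFields.BalabanUV.T4Continuum.CovariantBlockAveraging (contour transport QcovLev)
open Summit.QuantumFields.BalabanUV.T4Continuum.ColourCovariantLaplacian (covPertC negConnM zfieldC)
open Summit.QuantumFields.BalabanUV.T4Continuum.RegularBackgroundTower (RegularTransporters negConnM_eq_neg norm_connTower_le
  connTower_lipschitz norm_zTower_le)
open Summit.QuantumFields.BalabanUV.T4Continuum.KroneckerUnits (norm_entry_le)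
open Summit.QuantumFields.BalabanUV.T4Continuum.NE2BalabanLayer (tierBPert)
open Summit.QuantumFields.BalabanUV.T4Continuum.NE2BalabanRoot (avgPert balabanPert)
open Summit.QuantumFields.BalabanUV.T4Continuum.NE2ColourPerturbedLayer (pertCovC pertLimC)
open Summit.QuantumFields.BalabanUV.T4Continuum.DecayRateInterpolation (EntryDecay DecayRate TwoLevelDecayRate)
open Summit.QuantumFields.BalabanUV.T4Continuum.NE2BalabanDecayRate (decayStations_pertCovC)
open Summit.QuantumFields.BalabanUV.T4Continuum.WeightedRowSumResolvent (wrow_mul_le wrow_nonneg)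
open Summit.QuantumFields.BalabanUV.T4Continuum.SmallCouplingEntryDecay (torusSupNorm_rep_triangle torusSupNorm_rep_nonneg wrow_calGlev_kron_le)
open Summit.QuantumFields.BalabanUV.T4Continuum.SmallCouplingEntryDecayRel (hdec_pertCovC_small_rel)
open Summit.QuantumFields.BalabanUV.T4Continuum.SmallCouplingEntryDecayGrad (wrow_add_le wrow_firstOrder_mul_calGlev_le)
open Summit.QuantumFields.BalabanUV.T4Continuum.SmallCouplingEntryDecayCovariant (covPertC_eq_leftClass wrow_Cfirst_le wrow_Czero_le)
open Summit.QuantumFields.BalabanUV.T4Continuum.AveragingKernelRows (wrow_gram_sub_le)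

variable {d : ℕ} (L : ℕ) [NeZero L] (M : Fin (d + 1) → ℕ) [hM : ∀ μ, NeZero (M μ)]
variable {o : Type*} [Fintype o] [DecidableEq o]

/-! ## §1 Weighted rows of Bałaban's covariant-averaging summand -/

/-- **WEIGHTED ROWS OF `avgPert`** (any averaging weight `a`, dimension `d + 1`): under the displayed transport entry law at level `k`,
`Σ_j e^{δ′ρ}‖(avgPert L M a R k)(i,j)‖ ≤ ‖a‖·(card o)²·τ(2+τ)·e^{2δ′}` — `AveragingKernelRows.wrow_gram_sub_le` × the prefactor `a·n_k^{d+1}`,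
the volume factor cancelled by the column sums of `qr`. [folklore] -/
theorem wrow_avgPert_le (a : ℝ) {R : (k : ℕ) → Fin (d + 1) → (idx L M k → Matrix o o ℂ)} {τ : ℝ} (hτ : 0 ≤ τ) (k : ℕ)
    (hT : ∀ y j μ (t : Fin (lev L k)), ‖transport (fine (lev L k) M) (R k) μ (contour (lev L k) M y j μ t) - 1‖ ≤ τ)
    {δ' : ℝ} (hδ : 0 ≤ δ') (i : idx L M k × o) :
    ∑ j : idx L M k × o, Real.exp (δ' * torusSupNorm M (rep M (blockOf (lev L k) M i.1.1) - rep M (blockOf (lev L k) M j.1.1)))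
        * ‖avgPert L M a R k i j‖ ≤ ‖(a : ℂ)‖ * ((Fintype.card o : ℝ) ^ 2 * (τ * (2 + τ)) * Real.exp (2 * δ')) := by
  have hn : (0 : ℝ) < ((lev L k : ℕ) : ℝ) ^ (d + 1) := pow_pos (by exact_mod_cast Nat.pos_of_ne_zero (NeZero.ne (lev L k))) _
  have hsum : ∑ j : idx L M k × o, Real.exp (δ' * torusSupNorm M (rep M (blockOf (lev L k) M i.1.1) - rep M (blockOf (lev L k) M j.1.1)))
        * ‖avgPert L M a R k i j‖
      = ‖(a : ℂ)‖ * (((lev L k : ℕ) : ℝ) ^ (d + 1)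
        * ∑ j : idx L M k × o, Real.exp (δ' * torusSupNorm M (rep M (blockOf (lev L k) M i.1.1) - rep M (blockOf (lev L k) M j.1.1)))
          * ‖((QcovLev L M R k)ᴴ * QcovLev L M R k - ((QvOp (lev L k) M)ᴴ * QvOp (lev L k) M) ⊗ₖ (1 : Matrix o o ℂ)) i j‖) := by
    rw [Finset.mul_sum, Finset.mul_sum]
    refine Finset.sum_congr rfl fun j _ => ?_
    simp only [avgPert, Matrix.smul_apply, smul_eq_mul, norm_mul, norm_pow, Complex.norm_natCast]
    ring
  rw [hsum]
  refine mul_le_mul_of_nonneg_left ?_ (norm_nonneg _)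
  calc ((lev L k : ℕ) : ℝ) ^ (d + 1) * _ ≤ ((lev L k : ℕ) : ℝ) ^ (d + 1)
        * ((Fintype.card o : ℝ) ^ 2 * (τ * (2 + τ)) * Real.exp (2 * δ') * (1 / ((lev L k : ℕ) : ℝ) ^ (d + 1))) :=
        mul_le_mul_of_nonneg_left (wrow_gram_sub_le L M hτ k hT hδ i) hn.le
    _ = (Fintype.card o : ℝ) ^ 2 * (τ * (2 + τ)) * Real.exp (2 * δ') := by field_simp

/-! ## §2 The weighted (H-bd) analogue for the whole tier-B perturbation -/

/-- the typed tier-B perturbation is the sum of its three summands (definitional). [folklore] -/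
theorem balabanPert_apply (a : ℝ) (R : (k : ℕ) → Fin (d + 1) → (idx L M k → Matrix o o ℂ))
    (P₄ : (k : ℕ) → Matrix (idx L M k × o) (idx L M k × o) ℂ) (k : ℕ) :
    balabanPert L M a R P₄ k = covPertC L M R k + avgPert L M a R k + P₄ k := rfl

/-- **THE WEIGHTED (H-bd) ANALOGUE FOR `balabanPert L M 1 R P₄`** on King's tower over a cubic unit torus: for `hreg : RegularTransporters L M R α β`,
the transport entry law `hT`, the displayed weighted relative bound `hP₄w` of the gauge slot, and `0 ≤ δ′ < min(δ_∇, δ₁, δ₂)`: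
`Σ_j e^{δ′ρ}‖(balabanPert k·(𝒢^{(k)}⊗1))(i,j)‖ ≤ κ_cov + κ_avg·W_G(δ′) + κ₄w` at EVERY level. [folklore] -/
theorem wrow_balabanPert_mul_calGlev_le {Bg δg : ℝ}
    (hgrad : ∀ (n N₀ : ℕ) [NeZero n] [NeZero N₀] (δ' : ℝ), δ' < δg →
      ∀ (ν : Fin (d + 1)) (i : Tor (fine n (fun _ : Fin (d + 1) => N₀)) × Fin (d + 1)),
        ∑ x' : Tor (fine n (fun _ : Fin (d + 1) => N₀)) × Fin (d + 1),
            Real.exp (δ' * torusSupNorm (fun _ : Fin (d + 1) => N₀)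
                (rep (fun _ : Fin (d + 1) => N₀) (blockOf n (fun _ : Fin (d + 1) => N₀) i.1)
                  - rep (fun _ : Fin (d + 1) => N₀) (blockOf n (fun _ : Fin (d + 1) => N₀) x'.1)))
              * ‖(fdiff (fine n (fun _ : Fin (d + 1) => N₀)) (n : ℂ) ν * (DeltaA n (fun _ : Fin (d + 1) => N₀) 1)⁻¹) i x'‖
          ≤ Bg * latticeConst (d + 1) (δg - δ'))
    (N₀ : ℕ) [NeZero N₀] (hMc : M = fun _ => N₀) {δ' : ℝ} (hδ0 : 0 ≤ δ') (hδg : δ' < δg)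
    (h₁ : δ' < 1 / (2 * ((d : ℝ) + 1))) (h₂ : δ' < kappa183 (d + 1) / (d + 1))
    {R : (k : ℕ) → Fin (d + 1) → (idx L M k → Matrix o o ℂ)} {α β : ℝ} (hreg : RegularTransporters L M R α β)
    {τ : ℝ} (hτ : 0 ≤ τ)
    (hT : ∀ k y j μ (t : Fin (lev L k)), ‖transport (fine (lev L k) M) (R k) μ (contour (lev L k) M y j μ t) - 1‖ ≤ τ)
    {P₄ : (k : ℕ) → Matrix (idx L M k × o) (idx L M k × o) ℂ} {κ₄w : ℝ}
    (hP₄w : ∀ k (i : idx L M k × o), ∑ j, Real.exp (δ' * torusSupNorm M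
        (rep M (blockOf (lev L k) M i.1.1) - rep M (blockOf (lev L k) M j.1.1)))
        * ‖(P₄ k * (calGlev L M 1 one_pos k ⊗ₖ (1 : Matrix o o ℂ))) i j‖ ≤ κ₄w)
    (k : ℕ) (i : idx L M k × o) :
    ∑ j, Real.exp (δ' * torusSupNorm M (rep M (blockOf (lev L k) M i.1.1) - rep M (blockOf (lev L k) M j.1.1)))
        * ‖(balabanPert L M 1 R P₄ k * (calGlev L M 1 one_pos k ⊗ₖ (1 : Matrix o o ℂ))) i j‖
      ≤ (((d + 1) * (((Fintype.card o : ℝ) * α + Real.exp δ' * ((Fintype.card o : ℝ) * α)) * (Bg * latticeConst (d + 1) (δg - δ')))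
        + ((d + 1) * (Real.exp δ' * ((Fintype.card o : ℝ) * β)) + (Fintype.card o : ℝ) * (((d + 1 : ℕ) : ℝ) * (α ^ 2 + 2 * β))) * (2 * d * 2 ^ d * Real.exp (1 / (2 * (d + 1))) * latticeConst (d + 1) (1 / (2 * (d + 1)) - δ')
            + (d + 1) * (MD183 (d + 1) d * periodConst (kappa183 (d + 1)) d * latticeConst (d + 1) (kappa183 (d + 1) / (d + 1) - δ'))))
        + ((Fintype.card o : ℝ) ^ 2 * (τ * (2 + τ)) * Real.exp (2 * δ')) * (2 * d * 2 ^ d * Real.exp (1 / (2 * (d + 1))) * latticeConst (d + 1) (1 / (2 * (d + 1)) - δ')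
            + (d + 1) * (MD183 (d + 1) d * periodConst (kappa183 (d + 1)) d * latticeConst (d + 1) (kappa183 (d + 1) / (d + 1) - δ')))
        + κ₄w) := by
  have hw : ∀ i j : idx L M k × o,
      0 ≤ Real.exp (δ' * torusSupNorm M (rep M (blockOf (lev L k) M i.1.1) - rep M (blockOf (lev L k) M j.1.1))) :=
    fun _ _ => (Real.exp_pos _).le
  have htri : ∀ i j m : idx L M k × o,
      torusSupNorm M (rep M (blockOf (lev L k) M i.1.1) - rep M (blockOf (lev L k) M m.1.1))
        ≤ torusSupNorm M (rep M (blockOf (lev L k) M i.1.1) - rep M (blockOf (lev L k) M j.1.1))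
          + torusSupNorm M (rep M (blockOf (lev L k) M j.1.1) - rep M (blockOf (lev L k) M m.1.1)) :=
    fun i j m => torusSupNorm_rep_triangle M _ _ _
  -- (1) the covariant-Laplacian summand, regrouped, through file-2-of-GRAD's left-class bound
  have hcov : ∑ j, Real.exp (δ' * torusSupNorm M (rep M (blockOf (lev L k) M i.1.1) - rep M (blockOf (lev L k) M j.1.1)))
        * ‖(covPertC L M R k * (calGlev L M 1 one_pos k ⊗ₖ (1 : Matrix o o ℂ))) i j‖ ≤ ((d + 1) * (((Fintype.card o : ℝ) * α + Real.exp δ' * ((Fintype.card o : ℝ) * α)) * (Bg * latticeConst (d + 1) (δg - δ')))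
        + ((d + 1) * (Real.exp δ' * ((Fintype.card o : ℝ) * β)) + (Fintype.card o : ℝ) * (((d + 1 : ℕ) : ℝ) * (α ^ 2 + 2 * β))) * (2 * d * 2 ^ d * Real.exp (1 / (2 * (d + 1))) * latticeConst (d + 1) (1 / (2 * (d + 1)) - δ')
            + (d + 1) * (MD183 (d + 1) d * periodConst (kappa183 (d + 1)) d * latticeConst (d + 1) (kappa183 (d + 1) / (d + 1) - δ')))) := by
    have e := covPertC_eq_leftClass L M R k
    rw [e]
    exact wrow_firstOrder_mul_calGlev_le L M hgrad N₀ hMc hδ0 hδg h₁ h₂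
      (C := fun ν k => siteMul (negConnM (fine (lev L k) M) ((lev L k : ℕ) : ℂ) (R k) ν)
            - (shiftM (fine (lev L k) M) ν ⊗ₖ (1 : Matrix o o ℂ))ᴴ
              * siteMul (fun i => (negConnM (fine (lev L k) M) ((lev L k : ℕ) : ℂ) (R k) ν (tau (fine (lev L k) M) ν i))ᴴ))
      (C₀ := fun k => (∑ ν, -((shiftM (fine (lev L k) M) ν ⊗ₖ (1 : Matrix o o ℂ))ᴴ
              * siteMul (fun i => ((lev L k : ℕ) : ℂ) • ((negConnM (fine (lev L k) M) ((lev L k : ℕ) : ℂ) (R k) ν (tau (fine (lev L k) M) ν i))ᴴ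
                  - (negConnM (fine (lev L k) M) ((lev L k : ℕ) : ℂ) (R k) ν i)ᴴ))))
           + siteMul (zfieldC (fine (lev L k) M) ((lev L k : ℕ) : ℂ) (R k)))
      (fun ν k i => wrow_Cfirst_le L M k (fun ν i a b => by
          rw [negConnM_eq_neg, Matrix.neg_apply, norm_neg]
          exact (norm_entry_le _ a b).trans (norm_connTower_le hreg k ν i)) hδ0 ν i)
      (fun k i => wrow_Czero_le L M k (fun ν i a b => by
          rw [negConnM_eq_neg, negConnM_eq_neg, Matrix.neg_apply, Matrix.neg_apply, neg_sub_neg, ← Matrix.sub_apply, ← neg_sub,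
            Matrix.neg_apply, norm_neg]
          exact (norm_entry_le _ a b).trans (connTower_lipschitz hreg k ν ν i))
        (fun i a b => (norm_entry_le _ a b).trans (norm_zTower_le hreg k i)) hδ0 i) k i
  -- (2) the averaging summand: rows(avgPert)·W_G
  have havg : ∑ j, Real.exp (δ' * torusSupNorm M (rep M (blockOf (lev L k) M i.1.1) - rep M (blockOf (lev L k) M j.1.1)))
        * ‖(avgPert L M 1 R k * (calGlev L M 1 one_pos k ⊗ₖ (1 : Matrix o o ℂ))) i j‖ ≤ ((Fintype.card o : ℝ) ^ 2 * (τ * (2 + τ)) * Real.exp (2 * δ')) * (2 * d * 2 ^ d * Real.exp (1 / (2 * (d + 1))) * latticeConst (d + 1) (1 / (2 * (d + 1)) - δ')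
            + (d + 1) * (MD183 (d + 1) d * periodConst (kappa183 (d + 1)) d * latticeConst (d + 1) (kappa183 (d + 1) / (d + 1) - δ'))) := by
    have hWG : 0 ≤ (2 * d * 2 ^ d * Real.exp (1 / (2 * (d + 1))) * latticeConst (d + 1) (1 / (2 * (d + 1)) - δ')
            + (d + 1) * (MD183 (d + 1) d * periodConst (kappa183 (d + 1)) d * latticeConst (d + 1) (kappa183 (d + 1) / (d + 1) - δ'))) :=
      (wrow_nonneg (fun i j : idx L M k × o => torusSupNorm M (rep M (blockOf (lev L k) M i.1.1) - rep M (blockOf (lev L k) M j.1.1))) δ'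
        (calGlev L M 1 one_pos k ⊗ₖ (1 : Matrix o o ℂ)) i).trans (wrow_calGlev_kron_le L M h₁ h₂ k i)
    refine (wrow_mul_le htri hδ0 _ _ (fun j => wrow_calGlev_kron_le L M h₁ h₂ k j) i).trans (mul_le_mul_of_nonneg_right ?_ hWG)
    have h := wrow_avgPert_le L M 1 hτ k (hT k) hδ0 i
    rwa [Complex.ofReal_one, norm_one, one_mul] at h
  -- (3) assemble with the displayed gauge-slot bound
  rw [balabanPert_apply, Matrix.add_mul, Matrix.add_mul]
  refine (wrow_add_le _ hw _ _ i).trans (add_le_add ((wrow_add_le _ hw _ _ i).trans (add_le_add hcov havg)) (hP₄w k i))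

/-! ## §3 `hdec` and the decay stations for the typed tier-B perturbation -/

/-- **`hdec` FOR `balabanPert L M 1 R P₄` AT SMALL COUPLING** on King's tower over a cubic unit torus (a = 1): with
`κ_w = κ_cov(α, β) + κ_avg(τ)·W_G(δ′) + κ₄w` as in §2 and `‖t‖·κ_w < 1`,
`∀ k, EntryDecay dist₀ (pertCovC L M 1 _ (balabanPert L M 1 R P₄) t k) (W_G(δ′)∕(1 − ‖t‖κ_w)) δ′` — gen 5's `hdec_pertCovC_small_rel` BY NAME.
Displayed: `hreg`, `hT`, `hP₄w` (no NE3, no opaque `hdec`).  MODEL level; Δ3 NOT closed for Bałaban's carrier; NE2 NOT proved. [folklore] -/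
theorem hdec_pertCovC_balabanPert {Bg δg : ℝ}
    (hgrad : ∀ (n N₀ : ℕ) [NeZero n] [NeZero N₀] (δ' : ℝ), δ' < δg →
      ∀ (ν : Fin (d + 1)) (i : Tor (fine n (fun _ : Fin (d + 1) => N₀)) × Fin (d + 1)),
        ∑ x' : Tor (fine n (fun _ : Fin (d + 1) => N₀)) × Fin (d + 1),
            Real.exp (δ' * torusSupNorm (fun _ : Fin (d + 1) => N₀)
                (rep (fun _ : Fin (d + 1) => N₀) (blockOf n (fun _ : Fin (d + 1) => N₀) i.1)
                  - rep (fun _ : Fin (d + 1) => N₀) (blockOf n (fun _ : Fin (d + 1) => N₀) x'.1)))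
              * ‖(fdiff (fine n (fun _ : Fin (d + 1) => N₀)) (n : ℂ) ν * (DeltaA n (fun _ : Fin (d + 1) => N₀) 1)⁻¹) i x'‖
          ≤ Bg * latticeConst (d + 1) (δg - δ'))
    (N₀ : ℕ) [NeZero N₀] (hMc : M = fun _ => N₀) {δ' : ℝ} (hδ0 : 0 ≤ δ') (hδg : δ' < δg)
    (h₁ : δ' < 1 / (2 * ((d : ℝ) + 1))) (h₂ : δ' < kappa183 (d + 1) / (d + 1))
    {R : (k : ℕ) → Fin (d + 1) → (idx L M k → Matrix o o ℂ)} {α β : ℝ} (hreg : RegularTransporters L M R α β)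
    {τ : ℝ} (hτ : 0 ≤ τ)
    (hT : ∀ k y j μ (t : Fin (lev L k)), ‖transport (fine (lev L k) M) (R k) μ (contour (lev L k) M y j μ t) - 1‖ ≤ τ)
    {P₄ : (k : ℕ) → Matrix (idx L M k × o) (idx L M k × o) ℂ} {κ₄w : ℝ}
    (hP₄w : ∀ k (i : idx L M k × o), ∑ j, Real.exp (δ' * torusSupNorm M
        (rep M (blockOf (lev L k) M i.1.1) - rep M (blockOf (lev L k) M j.1.1)))
        * ‖(P₄ k * (calGlev L M 1 one_pos k ⊗ₖ (1 : Matrix o o ℂ))) i j‖ ≤ κ₄w)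
    {t : ℂ} (ht : ‖t‖ * (((d + 1) * (((Fintype.card o : ℝ) * α + Real.exp δ' * ((Fintype.card o : ℝ) * α)) * (Bg * latticeConst (d + 1) (δg - δ')))
        + ((d + 1) * (Real.exp δ' * ((Fintype.card o : ℝ) * β)) + (Fintype.card o : ℝ) * (((d + 1 : ℕ) : ℝ) * (α ^ 2 + 2 * β))) * (2 * d * 2 ^ d * Real.exp (1 / (2 * (d + 1))) * latticeConst (d + 1) (1 / (2 * (d + 1)) - δ')
            + (d + 1) * (MD183 (d + 1) d * periodConst (kappa183 (d + 1)) d * latticeConst (d + 1) (kappa183 (d + 1) / (d + 1) - δ'))))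
        + ((Fintype.card o : ℝ) ^ 2 * (τ * (2 + τ)) * Real.exp (2 * δ')) * (2 * d * 2 ^ d * Real.exp (1 / (2 * (d + 1))) * latticeConst (d + 1) (1 / (2 * (d + 1)) - δ')
            + (d + 1) * (MD183 (d + 1) d * periodConst (kappa183 (d + 1)) d * latticeConst (d + 1) (kappa183 (d + 1) / (d + 1) - δ')))
        + κ₄w) < 1) (k : ℕ) :
    EntryDecay (fun x y : idx L M 0 × o => torusSupNorm M (fun ν => (((x.1.1 ν).val : ℕ) : ℤ) - (((y.1.1 ν).val : ℕ) : ℤ)))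
      (pertCovC L M 1 one_pos (balabanPert L M 1 R P₄) t k) ((2 * d * 2 ^ d * Real.exp (1 / (2 * (d + 1))) * latticeConst (d + 1) (1 / (2 * (d + 1)) - δ')
            + (d + 1) * (MD183 (d + 1) d * periodConst (kappa183 (d + 1)) d * latticeConst (d + 1) (kappa183 (d + 1) / (d + 1) - δ'))) / (1 - ‖t‖ * (((d + 1) * (((Fintype.card o : ℝ) * α + Real.exp δ' * ((Fintype.card o : ℝ) * α)) * (Bg * latticeConst (d + 1) (δg - δ')))
        + ((d + 1) * (Real.exp δ' * ((Fintype.card o : ℝ) * β)) + (Fintype.card o : ℝ) * (((d + 1 : ℕ) : ℝ) * (α ^ 2 + 2 * β))) * (2 * d * 2 ^ d * Real.exp (1 / (2 * (d + 1))) * latticeConst (d + 1) (1 / (2 * (d + 1)) - δ')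
            + (d + 1) * (MD183 (d + 1) d * periodConst (kappa183 (d + 1)) d * latticeConst (d + 1) (kappa183 (d + 1) / (d + 1) - δ'))))
        + ((Fintype.card o : ℝ) ^ 2 * (τ * (2 + τ)) * Real.exp (2 * δ')) * (2 * d * 2 ^ d * Real.exp (1 / (2 * (d + 1))) * latticeConst (d + 1) (1 / (2 * (d + 1)) - δ')
            + (d + 1) * (MD183 (d + 1) d * periodConst (kappa183 (d + 1)) d * latticeConst (d + 1) (kappa183 (d + 1) / (d + 1) - δ')))
        + κ₄w))) δ' :=
  hdec_pertCovC_small_rel L M hδ0 h₁ h₂ (P := balabanPert L M 1 R P₄)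
    (fun k i => wrow_balabanPert_mul_calGlev_le L M hgrad N₀ hMc hδ0 hδg h₁ h₂ hreg hτ hT hP₄w k i) ht k

/-- **ROOT B's DECAY STATIONS WITH `hdec` DISCHARGED** (`L ≥ 2`, a = 1, cubic unit torus): for ANY tier-B `PerturbationLaws` witness `hpert` of
`balabanPert L M 1 R P₄` (e.g. `NE2BalabanRoot.perturbationLaws_balaban`, CONDITIONAL on node NE3, `hreg`, `hE`, `hP₄` as displayed THERE), a
coupling in both discs, and §3's data: the owner's `NE2BalabanDecayRate.decayStations_pertCovC` BY NAME — limit entry decay of `pertLimC`, King's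
(4.38) limit rate `DecayRate … (δ′∕2) √(L⁻¹)` and the two-level rate — with `hdec := hdec_pertCovC_balabanPert`.  Referee c14's «hdec (open)» is
thereby RE-TYPED for cubic tori at a = 1: OPEN = the transport entry law `hT` + the weighted gauge-slot bound `hP₄w` (+ NE3 etc. inside `hpert`).
MODEL level; NE2 NOT proved. [cite: King1986, Lemma 4.5 (4.38) p.674 (shape)] [folklore] -/
theorem decayStations_balabanPert (hL : 2 ≤ L) {Bg δg : ℝ}
    (hgrad : ∀ (n N₀ : ℕ) [NeZero n] [NeZero N₀] (δ' : ℝ), δ' < δg →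
      ∀ (ν : Fin (d + 1)) (i : Tor (fine n (fun _ : Fin (d + 1) => N₀)) × Fin (d + 1)),
        ∑ x' : Tor (fine n (fun _ : Fin (d + 1) => N₀)) × Fin (d + 1),
            Real.exp (δ' * torusSupNorm (fun _ : Fin (d + 1) => N₀)
                (rep (fun _ : Fin (d + 1) => N₀) (blockOf n (fun _ : Fin (d + 1) => N₀) i.1)
                  - rep (fun _ : Fin (d + 1) => N₀) (blockOf n (fun _ : Fin (d + 1) => N₀) x'.1)))
              * ‖(fdiff (fine n (fun _ : Fin (d + 1) => N₀)) (n : ℂ) ν * (DeltaA n (fun _ : Fin (d + 1) => N₀) 1)⁻¹) i x'‖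
          ≤ Bg * latticeConst (d + 1) (δg - δ'))
    (N₀ : ℕ) [NeZero N₀] (hMc : M = fun _ => N₀) {δ' : ℝ} (hδ0 : 0 ≤ δ') (hδg : δ' < δg)
    (h₁ : δ' < 1 / (2 * ((d : ℝ) + 1))) (h₂ : δ' < kappa183 (d + 1) / (d + 1))
    {R : (k : ℕ) → Fin (d + 1) → (idx L M k → Matrix o o ℂ)} {α β : ℝ} (hreg : RegularTransporters L M R α β)
    {τ : ℝ} (hτ : 0 ≤ τ)
    (hT : ∀ k y j μ (t : Fin (lev L k)), ‖transport (fine (lev L k) M) (R k) μ (contour (lev L k) M y j μ t) - 1‖ ≤ τ)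
    {P₄ : (k : ℕ) → Matrix (idx L M k × o) (idx L M k × o) ℂ} {κ₄w : ℝ}
    (hP₄w : ∀ k (i : idx L M k × o), ∑ j, Real.exp (δ' * torusSupNorm M
        (rep M (blockOf (lev L k) M i.1.1) - rep M (blockOf (lev L k) M j.1.1)))
        * ‖(P₄ k * (calGlev L M 1 one_pos k ⊗ₖ (1 : Matrix o o ℂ))) i j‖ ≤ κ₄w)
    {κ C₂ : ℝ} (hpert : PerturbationLaws (fun k => calDalev L M 1 one_pos k ⊗ₖ (1 : Matrix o o ℂ)) (balabanPert L M 1 R P₄)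
      (fun k => JpcT L M k ⊗ₖ (1 : Matrix o o ℂ)) κ (fun k => C₂ * ((L : ℝ)⁻¹) ^ k))
    {t : ℂ} (htκ : ‖t‖ * κ < 1) (ht : ‖t‖ * (((d + 1) * (((Fintype.card o : ℝ) * α + Real.exp δ' * ((Fintype.card o : ℝ) * α)) * (Bg * latticeConst (d + 1) (δg - δ')))
        + ((d + 1) * (Real.exp δ' * ((Fintype.card o : ℝ) * β)) + (Fintype.card o : ℝ) * (((d + 1 : ℕ) : ℝ) * (α ^ 2 + 2 * β))) * (2 * d * 2 ^ d * Real.exp (1 / (2 * (d + 1))) * latticeConst (d + 1) (1 / (2 * (d + 1)) - δ')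
            + (d + 1) * (MD183 (d + 1) d * periodConst (kappa183 (d + 1)) d * latticeConst (d + 1) (kappa183 (d + 1) / (d + 1) - δ'))))
        + ((Fintype.card o : ℝ) ^ 2 * (τ * (2 + τ)) * Real.exp (2 * δ')) * (2 * d * 2 ^ d * Real.exp (1 / (2 * (d + 1))) * latticeConst (d + 1) (1 / (2 * (d + 1)) - δ')
            + (d + 1) * (MD183 (d + 1) d * periodConst (kappa183 (d + 1)) d * latticeConst (d + 1) (kappa183 (d + 1) / (d + 1) - δ')))
        + κ₄w) < 1) :
    EntryDecay (fun x y : idx L M 0 × o => torusSupNorm M (fun ν => (((x.1.1 ν).val : ℕ) : ℤ) - (((y.1.1 ν).val : ℕ) : ℤ)))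
        (pertLimC L M 1 one_pos (balabanPert L M 1 R P₄) t) ((2 * d * 2 ^ d * Real.exp (1 / (2 * (d + 1))) * latticeConst (d + 1) (1 / (2 * (d + 1)) - δ')
            + (d + 1) * (MD183 (d + 1) d * periodConst (kappa183 (d + 1)) d * latticeConst (d + 1) (kappa183 (d + 1) / (d + 1) - δ'))) / (1 - ‖t‖ * (((d + 1) * (((Fintype.card o : ℝ) * α + Real.exp δ' * ((Fintype.card o : ℝ) * α)) * (Bg * latticeConst (d + 1) (δg - δ')))
        + ((d + 1) * (Real.exp δ' * ((Fintype.card o : ℝ) * β)) + (Fintype.card o : ℝ) * (((d + 1 : ℕ) : ℝ) * (α ^ 2 + 2 * β))) * (2 * d * 2 ^ d * Real.exp (1 / (2 * (d + 1))) * latticeConst (d + 1) (1 / (2 * (d + 1)) - δ')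
            + (d + 1) * (MD183 (d + 1) d * periodConst (kappa183 (d + 1)) d * latticeConst (d + 1) (kappa183 (d + 1) / (d + 1) - δ'))))
        + ((Fintype.card o : ℝ) ^ 2 * (τ * (2 + τ)) * Real.exp (2 * δ')) * (2 * d * 2 ^ d * Real.exp (1 / (2 * (d + 1))) * latticeConst (d + 1) (1 / (2 * (d + 1)) - δ')
            + (d + 1) * (MD183 (d + 1) d * periodConst (kappa183 (d + 1)) d * latticeConst (d + 1) (kappa183 (d + 1) / (d + 1) - δ')))
        + κ₄w))) δ' ∧
      DecayRate (fun x y : idx L M 0 × o => torusSupNorm M (fun ν => (((x.1.1 ν).val : ℕ) : ℤ) - (((y.1.1 ν).val : ℕ) : ℤ)))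
        (pertCovC L M 1 one_pos (balabanPert L M 1 R P₄) t) (pertLimC L M 1 one_pos (balabanPert L M 1 R P₄) t)
        (Real.sqrt (2 * ((2 * d * 2 ^ d * Real.exp (1 / (2 * (d + 1))) * latticeConst (d + 1) (1 / (2 * (d + 1)) - δ')
            + (d + 1) * (MD183 (d + 1) d * periodConst (kappa183 (d + 1)) d * latticeConst (d + 1) (kappa183 (d + 1) / (d + 1) - δ'))) / (1 - ‖t‖ * (((d + 1) * (((Fintype.card o : ℝ) * α + Real.exp δ' * ((Fintype.card o : ℝ) * α)) * (Bg * latticeConst (d + 1) (δg - δ')))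
        + ((d + 1) * (Real.exp δ' * ((Fintype.card o : ℝ) * β)) + (Fintype.card o : ℝ) * (((d + 1 : ℕ) : ℝ) * (α ^ 2 + 2 * β))) * (2 * d * 2 ^ d * Real.exp (1 / (2 * (d + 1))) * latticeConst (d + 1) (1 / (2 * (d + 1)) - δ')
            + (d + 1) * (MD183 (d + 1) d * periodConst (kappa183 (d + 1)) d * latticeConst (d + 1) (kappa183 (d + 1) / (d + 1) - δ'))))
        + ((Fintype.card o : ℝ) ^ 2 * (τ * (2 + τ)) * Real.exp (2 * δ')) * (2 * d * 2 ^ d * Real.exp (1 / (2 * (d + 1))) * latticeConst (d + 1) (1 / (2 * (d + 1)) - δ')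
            + (d + 1) * (MD183 (d + 1) d * periodConst (kappa183 (d + 1)) d * latticeConst (d + 1) (kappa183 (d + 1) / (d + 1) - δ')))
        + κ₄w)))
          * (Cpert κ (2 * ((d + 1 : ℕ) : ℝ) * Cst (d + 1) 1) (CJ (d + 1) 1) C₂ 0 t / (1 - (L : ℝ)⁻¹)))) (δ' / 2) (Real.sqrt ((L : ℝ)⁻¹)) ∧
      TwoLevelDecayRate (fun x y : idx L M 0 × o => torusSupNorm M (fun ν => (((x.1.1 ν).val : ℕ) : ℤ) - (((y.1.1 ν).val : ℕ) : ℤ)))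
        (pertCovC L M 1 one_pos (balabanPert L M 1 R P₄) t)
        (Real.sqrt (2 * ((2 * d * 2 ^ d * Real.exp (1 / (2 * (d + 1))) * latticeConst (d + 1) (1 / (2 * (d + 1)) - δ')
            + (d + 1) * (MD183 (d + 1) d * periodConst (kappa183 (d + 1)) d * latticeConst (d + 1) (kappa183 (d + 1) / (d + 1) - δ'))) / (1 - ‖t‖ * (((d + 1) * (((Fintype.card o : ℝ) * α + Real.exp δ' * ((Fintype.card o : ℝ) * α)) * (Bg * latticeConst (d + 1) (δg - δ')))
        + ((d + 1) * (Real.exp δ' * ((Fintype.card o : ℝ) * β)) + (Fintype.card o : ℝ) * (((d + 1 : ℕ) : ℝ) * (α ^ 2 + 2 * β))) * (2 * d * 2 ^ d * Real.exp (1 / (2 * (d + 1))) * latticeConst (d + 1) (1 / (2 * (d + 1)) - δ')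
            + (d + 1) * (MD183 (d + 1) d * periodConst (kappa183 (d + 1)) d * latticeConst (d + 1) (kappa183 (d + 1) / (d + 1) - δ'))))
        + ((Fintype.card o : ℝ) ^ 2 * (τ * (2 + τ)) * Real.exp (2 * δ')) * (2 * d * 2 ^ d * Real.exp (1 / (2 * (d + 1))) * latticeConst (d + 1) (1 / (2 * (d + 1)) - δ')
            + (d + 1) * (MD183 (d + 1) d * periodConst (kappa183 (d + 1)) d * latticeConst (d + 1) (kappa183 (d + 1) / (d + 1) - δ')))
        + κ₄w)))
          * (2 * Cpert κ (2 * ((d + 1 : ℕ) : ℝ) * Cst (d + 1) 1) (CJ (d + 1) 1) C₂ 0 t / (1 - (L : ℝ)⁻¹)))) (δ' / 2) (Real.sqrt ((L : ℝ)⁻¹)) :=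
  decayStations_pertCovC L M 1 one_pos hL hpert htκ
    (hdec_pertCovC_balabanPert L M hgrad N₀ hMc hδ0 hδg h₁ h₂ hreg hτ hT hP₄w ht)

end Summit.QuantumFields.BalabanUV.T4Continuum.SmallCouplingEntryDecayTierB

end
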